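import Mathlib
import HarnessLib
import Literature.Analysis.FluidPDE.VorticityCalculus
import Literature.Analysis.FluidPDE.LerayProfileCalculus
import Summits.NavierStokesRegularity.NavierStokesRegularity.Theorems.TypeIQuarterGateScarEnvelopeTypeIForcedTsaiHomogeneousTail
import Summits.NavierStokesRegularity.NavierStokesRegularity.Theorems.TypeIQuarterGateScarEnvelopeTypeIForcedTsaiStokesletSelfAdvection
import Summits.NavierStokesRegularity.NavierStokesRegularity.Theorems.TypeIQuarterGateScarEnvelopeTypeIForcedTsaiStokesletTailObstruction
import Summits.NavierStokesRegularity.NavierStokesRegularity.Theorems.LandauTailHomSteadyProfileExistsMomentum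

/-!
# ARM B — EXACT LANDAU TAILS ARE ADMISSIBLE IN THE REGISTERED CURRENCY: the registered vorticity
  residual of Landau's solution vanishes identically off the origin (ns-wall-extremal, (C2) of
  LINEAR-FLOOR §3 / DATUM B-2k as a kernel sentence)

Cell ns-wall-extremal, seat ns-wall-eng-1 g7.  The lineage's kernel census of exact Type-I TAILS in the
registered currency of `…ForcedTsaiDefs` (`g = curl(−ΔU + ½U + ½DU·y + (U·∇)U)`, residual
`‖(1+|y|)^{5/2} g‖_{L²(ℝ³)}`) had so far only NEGATIVE entries:

* p694942 `not_integrable_residual_of_stokesletTail` — a field equal to a Stokeslet outside a ball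
  has a NON-integrable weighted residual (the self-advection `curl((U_e·∇)U_e) = −12⟨e,x⟩|x|⁻⁶ e×x`
  at order `|y|⁻⁴`);
* p698489 `not_integrable_residual_of_swirlTail` — the same for the exact swirl tail `(y×e)/|y|²`
  (already at LINEAR order).

THIS FILE ADDS THE POSITIVE ENTRY, with no new definition and no restated fact: Landau's
`(−1)`-homogeneous solutions `landauAxisField a c` (`Literature/…/SverakLandauClassification`,
unit axis `a`, `|c| > 1`), proved in the tree to solve the steady Navier–Stokes system off the origin
(`LandauTail.landauAxisField_momentum`, Landau 1944 / Lemarié-Rieusset 2016 Thm 10.13), have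

* `lerayMomentumResidual_landauAxisField` — registered momentum residual `= −∇P` off the origin
  (the Leray drift `½U + ½DU·y` vanishes on `(−1)`-homogeneous fields, p688729);
* ★ `lerayVorticityResidual_landauAxisField_eq_zero` — registered VORTICITY residual `g ≡ 0` on
  `ℝ³ ∖ {0}` (local `curl ∇ = 0`, p694429 `curl_gradient_eq_zero_of_contDiffAt`);
* `lerayVorticityResidual_eq_zero_of_landauTail` — a field that coincides with a Landau solution
  outside a closed ball has registered residual `≡ 0` there (locality, p694942
  `lerayVorticityResidual_congr`), so its weighted residual density is supported in the ball:
  `residualWeight_eq_zero_of_landauTail`, `tsupport_residualWeight_subset_of_landauTail`;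
* `divergence_eq_zero_of_landauTail` — and it is divergence free there (tree
  `LandauTail.divergence_landauAxisField`);
* `integrable_residualWeight_of_landauTail` — every `C³` continuation `U` of a Landau tail meets
  the INTEGRABILITY conjunct of the currency (`(1+‖y‖)⁵‖g_U‖²` is continuous —
  `continuous_lerayVorticityResidual` for `U ∈ C³` — and compactly supported), i.e. its registered
  residual is a finite, core-only number (no value claimed).

So, in the registered currency, «EXACT LANDAU TAILS ARE ADMISSIBLE (zero exterior residual, hence a
finite, core-only residual for every smooth continuation); EXACT STOKESLET AND SWIRL TAILS ARE NOT»
— the kernel form of (C2): a finite-residual near-profile with an exactly `(−1)`-homogeneous far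
field is Landau at infinity (the converse direction, via Šverák 2011, is the tree's named fact
`Sverak2011_landauClassification` and is not used here).

HONEST FRAME.  Identity-grade helper (`--supports stmt-NavierStokesRegularity-23843`); it exhibits
the admissible tail class of the currency, excludes nothing, bounds no modulus, constructs no
witness row (the CORE of a Landau-tailed field is not built here) and says nothing about
Navier–Stokes regularity.  Crux `ScarEnvelopeTypeI` (stmt-23843) / wall H3 OPEN; NS regularity NOT
proved.
-/

noncomputable section

set_option linter.dupNamespace false

namespace Summit.NavierStokesRegularity.NavierStokesRegularity.Cruxes.ScarEnvelopeTypeI.ForcedTsai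

open MeasureTheory Set Metric Filter Topology
open scoped ContDiff Laplacian InnerProductSpace RealInnerProductSpace
open Literature.Analysis.FluidPDE
open Summit.NavierStokesRegularity.NavierStokesRegularity.Theorems.LandauTail

namespace LandauTail

variable {a : E3} {c : ℝ}

/-- **Registered momentum residual of Landau's solution** off the origin: `= −∇P` with
`P = landauAxisPressure a c`.  The Leray drift `½U + ½DU·y` vanishes identically on the
`(−1)`-homogeneous field (p688729), and `−ΔU + (U·∇)U = −∇P` is Landau's theorem (tree). -/
theorem lerayMomentumResidual_landauAxisField (ha : ‖a‖ = 1) (hc : 1 < |c|) {x : E3} (hx : x ≠ 0) :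
    lerayMomentumResidual (landauAxisField a c) x = -(gradient (landauAxisPressure a c) x) := by
  have hd : DifferentiableAt ℝ (landauAxisField a c) x :=
    (contDiffAt_landauAxisField ha hc hx (n := 1)).differentiableAt one_ne_zero
  rw [lerayMomentumResidual_of_homogeneous_neg_one (fun t ht => landauAxisField_smul a c ht x) hd,
    ← landauAxisField_momentum ha hc hx]
  abel

/-- ★ **EXACT LANDAU TAILS HAVE ZERO REGISTERED VORTICITY RESIDUAL.**  For a unit axis `a` and
`|c| > 1`, `lerayVorticityResidual (landauAxisField a c) x = 0` at every `x ≠ 0`: near `x` the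
momentum residual is the gradient field `−∇P` with `P` smooth there, and `curl ∇P = 0` locally. -/
theorem lerayVorticityResidual_landauAxisField_eq_zero (ha : ‖a‖ = 1) (hc : 1 < |c|) {x : E3}
    (hx : x ≠ 0) : lerayVorticityResidual (landauAxisField a c) x = 0 := by
  have hne : ∀ᶠ y in 𝓝 x, y ≠ (0 : E3) := isOpen_ne.eventually_mem hx
  have hloc : lerayMomentumResidual (landauAxisField a c)
      =ᶠ[𝓝 x] fun y => -(gradient (landauAxisPressure a c) y) :=
    hne.mono fun y hy => lerayMomentumResidual_landauAxisField ha hc hy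
  have hP : ContDiffAt ℝ 2 (landauAxisPressure a c) x := contDiffAt_landauAxisPressure ha hc hx
  obtain ⟨-, hcurl⟩ := curl_gradient_eq_zero_of_contDiffAt hP
  rw [lerayVorticityResidual, curl_eq_curlCLM, hloc.fderiv_eq, ← curl_eq_curlCLM, curl_neg, hcurl,
    neg_zero]

/-- Landau's solution is divergence free off the origin (tree, restated pointwise in the cell's
vocabulary for convenience of citation: `VectorCalculus.divergence (landauAxisField a c) x = 0`). -/
theorem divergence_landauAxisField_eq_zero (ha : ‖a‖ = 1) (hc : 1 < |c|) {x : E3} (hx : x ≠ 0) :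
    VectorCalculus.divergence (landauAxisField a c) x = 0 :=
  divergence_landauAxisField ha hc hx

/-! ## Fields with an exact Landau tail -/

variable {U : E3 → E3} {ρ : ℝ}

/-- A point outside the closed ball of radius `ρ ≥ 0` is not the origin. -/
theorem ne_zero_of_lt_norm (hρ : 0 ≤ ρ) {x : E3} (hx : ρ < ‖x‖) : x ≠ 0 := by
  rintro rfl
  rw [norm_zero] at hx
  exact absurd hx (not_lt.mpr hρ)

/-- A field that equals the Landau solution on `{ρ < ‖y‖}` agrees with it near every such point. -/
theorem eventuallyEq_landauAxisField_of_landauTail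
    (hU : ∀ y : E3, ρ < ‖y‖ → U y = landauAxisField a c y) {x : E3} (hx : ρ < ‖x‖) :
    U =ᶠ[𝓝 x] landauAxisField a c := by
  have hopen : IsOpen {y : E3 | ρ < ‖y‖} := isOpen_lt continuous_const continuous_norm
  exact Filter.eventually_of_mem (hopen.mem_nhds hx) fun y hy => hU y hy

/-- **A field with an exact LANDAU TAIL has zero registered vorticity residual outside the ball**:
if `U = landauAxisField a c` on `{ρ < ‖y‖}` (`ρ ≥ 0`, unit axis, `|c| > 1`) then
`lerayVorticityResidual U x = 0` for every `ρ < ‖x‖` — the positive counterpart of the Stokeslet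
(p694942) and swirl (p698489) tail obstructions. -/
theorem lerayVorticityResidual_eq_zero_of_landauTail (ha : ‖a‖ = 1) (hc : 1 < |c|) (hρ : 0 ≤ ρ)
    (hU : ∀ y : E3, ρ < ‖y‖ → U y = landauAxisField a c y) {x : E3} (hx : ρ < ‖x‖) :
    lerayVorticityResidual U x = 0 := by
  rw [lerayVorticityResidual_congr (eventuallyEq_landauAxisField_of_landauTail hU hx)]
  exact lerayVorticityResidual_landauAxisField_eq_zero ha hc (ne_zero_of_lt_norm hρ hx)

/-- Consequently the registered weighted residual DENSITY `(1+‖y‖)⁵‖g_U(y)‖²` of a Landau-tailed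
field vanishes outside the ball. -/
theorem residualWeight_eq_zero_of_landauTail (ha : ‖a‖ = 1) (hc : 1 < |c|) (hρ : 0 ≤ ρ)
    (hU : ∀ y : E3, ρ < ‖y‖ → U y = landauAxisField a c y) {x : E3} (hx : ρ < ‖x‖) :
    (1 + ‖x‖) ^ 5 * ‖lerayVorticityResidual U x‖ ^ 2 = 0 := by
  rw [lerayVorticityResidual_eq_zero_of_landauTail ha hc hρ hU hx, norm_zero]
  ring

/-- The weighted residual density of a Landau-tailed field is supported in the closed ball
`‖y‖ ≤ ρ` (so the residual of any smooth continuation of a Landau tail is a CORE quantity). -/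
theorem support_residualWeight_subset_of_landauTail (ha : ‖a‖ = 1) (hc : 1 < |c|) (hρ : 0 ≤ ρ)
    (hU : ∀ y : E3, ρ < ‖y‖ → U y = landauAxisField a c y) :
    Function.support (fun y : E3 => (1 + ‖y‖) ^ 5 * ‖lerayVorticityResidual U y‖ ^ 2)
      ⊆ closedBall (0 : E3) ρ := by
  intro y hy
  rw [mem_closedBall, dist_zero_right]
  by_contra h
  exact hy (residualWeight_eq_zero_of_landauTail ha hc hρ hU (not_le.mp h))

/-- The topological support of the weighted residual density of a Landau-tailed field lies in the
closed ball `‖y‖ ≤ ρ`; in particular it is compact. -/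
theorem tsupport_residualWeight_subset_of_landauTail (ha : ‖a‖ = 1) (hc : 1 < |c|) (hρ : 0 ≤ ρ)
    (hU : ∀ y : E3, ρ < ‖y‖ → U y = landauAxisField a c y) :
    tsupport (fun y : E3 => (1 + ‖y‖) ^ 5 * ‖lerayVorticityResidual U y‖ ^ 2)
      ⊆ closedBall (0 : E3) ρ :=
  closure_minimal (support_residualWeight_subset_of_landauTail ha hc hρ hU) isClosed_closedBall

/-- The weighted residual density of a Landau-tailed field has compact support. -/
theorem hasCompactSupport_residualWeight_of_landauTail (ha : ‖a‖ = 1) (hc : 1 < |c|) (hρ : 0 ≤ ρ)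
    (hU : ∀ y : E3, ρ < ‖y‖ → U y = landauAxisField a c y) :
    HasCompactSupport (fun y : E3 => (1 + ‖y‖) ^ 5 * ‖lerayVorticityResidual U y‖ ^ 2) :=
  HasCompactSupport.of_support_subset_isCompact (isCompact_closedBall (0 : E3) ρ)
    (support_residualWeight_subset_of_landauTail ha hc hρ hU)

/-! ## The integrability conjunct for smooth continuations of a Landau tail -/

/-- Regularity bookkeeping: for `U ∈ C³(ℝ³;ℝ³)` the registered momentum residual
`−ΔU + ½U + ½DU·y + (U·∇)U` is `C¹`. -/
theorem contDiff_one_lerayMomentumResidual (hU : ContDiff ℝ 3 U) :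
    ContDiff ℝ 1 (lerayMomentumResidual U) := by
  have hU1 : ContDiff ℝ 1 U := hU.of_le (by norm_num)
  have hD2 : ContDiff ℝ 2 (fderiv ℝ U) := hU.fderiv_right (m := 2) (by norm_num)
  have hD1 : ContDiff ℝ 1 (fderiv ℝ U) := hD2.of_le (by norm_num)
  have hΔ : ContDiff ℝ 1 (Δ U) := contDiff_one_laplacian hU
  have hT : ContDiff ℝ 1 (fun y : E3 => fderiv ℝ U y y) := hD1.clm_apply contDiff_id
  have hN : ContDiff ℝ 1 (fun y : E3 => fderiv ℝ U y (U y)) := hD1.clm_apply hU1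
  have hdef : lerayMomentumResidual U = fun y : E3 =>
      -((Δ U) y) + (1 / 2 : ℝ) • U y + (1 / 2 : ℝ) • fderiv ℝ U y y + fderiv ℝ U y (U y) := rfl
  rw [hdef]
  exact ((hΔ.neg.add (hU1.const_smul (1 / 2 : ℝ))).add (hT.const_smul (1 / 2 : ℝ))).add hN

/-- For `U ∈ C³(ℝ³;ℝ³)` the registered vorticity residual `g_U` is continuous. -/
theorem continuous_lerayVorticityResidual (hU : ContDiff ℝ 3 U) :
    Continuous (lerayVorticityResidual U) := by
  have h : lerayVorticityResidual U = curl (lerayMomentumResidual U) := rfl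
  rw [h]
  exact continuous_curl (contDiff_one_lerayMomentumResidual hU)

/-- For `U ∈ C³(ℝ³;ℝ³)` the registered weighted residual density is continuous. -/
theorem continuous_residualWeight (hU : ContDiff ℝ 3 U) :
    Continuous (fun y : E3 => (1 + ‖y‖) ^ 5 * ‖lerayVorticityResidual U y‖ ^ 2) :=
  ((continuous_const.add continuous_norm).pow 5).mul
    ((continuous_lerayVorticityResidual hU).norm.pow 2)

/-- **Every `C³` continuation of a Landau tail satisfies the INTEGRABILITY conjunct of the registered
currency**: its weighted residual density `(1+‖y‖)⁵‖g_U‖²` is continuous and compactly supported,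
hence integrable — the registered residual of a Landau-tailed near-profile is a finite, core-only
number (contrast: `+∞` for exact Stokeslet / swirl tails, p694942 / p698489). No value is claimed. -/
theorem integrable_residualWeight_of_landauTail (ha : ‖a‖ = 1) (hc : 1 < |c|) (hρ : 0 ≤ ρ)
    (hU3 : ContDiff ℝ 3 U) (hU : ∀ y : E3, ρ < ‖y‖ → U y = landauAxisField a c y) :
    Integrable (fun y : E3 => (1 + ‖y‖) ^ 5 * ‖lerayVorticityResidual U y‖ ^ 2) :=
  (continuous_residualWeight hU3).integrable_of_hasCompactSupport
    (hasCompactSupport_residualWeight_of_landauTail ha hc hρ hU)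

/-- **A Landau-tailed field is divergence free outside the ball** (locality of `div` and the
tree's `divergence_landauAxisField`). -/
theorem divergence_eq_zero_of_landauTail (ha : ‖a‖ = 1) (hc : 1 < |c|) (hρ : 0 ≤ ρ)
    (hU : ∀ y : E3, ρ < ‖y‖ → U y = landauAxisField a c y) {x : E3} (hx : ρ < ‖x‖) :
    VectorCalculus.divergence U x = 0 := by
  have h := eventuallyEq_landauAxisField_of_landauTail hU hx
  rw [VectorCalculus.divergence, h.fderiv_eq, ← VectorCalculus.divergence]
  exact divergence_landauAxisField ha hc (ne_zero_of_lt_norm hρ hx)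

end LandauTail

end Summit.NavierStokesRegularity.NavierStokesRegularity.Cruxes.ScarEnvelopeTypeI.ForcedTsai

end
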